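import Summits.ResolutionOfSingularities.ResolutionOfSingularities.Theorems.WeightedInvariantP3aTieCurve
import Summits.ResolutionOfSingularities.ResolutionOfSingularities.Theorems.WeightedInvariantP3aSpecialFibreFace
import HarnessLib

/-!
# The P3a cylinder move: the three degenerate-face positions on the tie curve (ORDER (o36))

Topic: `Summits/ResolutionOfSingularities/ResolutionOfSingularities/Theorems`. Helper for the door item
`HypersurfaceCentreConstruction` (statement `stmt-ResolutionOfSingularities-19897`, route `WeightedInvariant`), line
`local-engine` of `res-L1-w43-plan-1`, IOTA3-DESIGN v1.3 §8.4 regime CURVE° (RULING gen 11 #2), ORDER (o36) held by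
res-type-092 (design memo `plan/tools/res-type-092/o36/O36-DESIGN.md` §4/§6; kernel plan v2, FILE C2b-I).

`S` regular local, `(y, x, z)` a regular system of parameters, `P = (y, x)` prime, `B = S[t⁻¹, 𝒥ₙ((y,x);(r,q)) tⁿ]`,
`Y = y t^r`, `X = x t^q`; charts `ρ` (`ker (t⁻¹)`) and `ρ₀` (`ker (t⁻¹, z)`, `ρ₀ Y = X₀`, `ρ₀ X = X₁`).  The three
shapes of a DEGENERATE special-fibre face put a successor `𝔫 ∋ t⁻¹, z` on one of the curves `Y = 0`, `Y = λ̃X^r`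
(`q = 1`), `X = 0` (`q = r = 1`); Lemma B (`LocalGameEFTCylinder.not_mem_pow_of_notMem_steepened`) then turns the
TIE-FREENESS hypothesis of (L3.2) into the order drop of the saturated transform `G` (`f = (t⁻¹)^{rν} G`):

* `notMem_pow_of_Y_mem` — `Y ∈ 𝔫 ∌ X`, `f ∉ 𝒥_{(r+1)ν}((x, y, z); (q, r+1, 1))` ⇒ `G/1 ∉ 𝔪_𝔫^ν`;
* `notMem_pow_of_steep_mem` — `q = 1`, `Y - λ̃X^r ∈ 𝔫 ∌ X`, `f ∉ 𝒥_{(r+1)ν}((x, y - λ̃x^r, z); (1, r+1, 1))` ⇒ same;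
* `notMem_pow_of_X_mem` — `q = r = 1`, `X ∈ 𝔫 ∌ Y`, `f ∉ 𝒥_{2ν}((y, x, z); (1, 2, 1))` ⇒ same;
plus the vertex-coefficient lemma `residue_vertex_ne_zero` («(L1)»: for `q < r` the coefficient of `y^ν` is a unit)
and `span_range_steepen` / `span_range_swap` (the regular systems `(x, y - λ̃x^r, z)`, `(x, y, z)`).

Def-free.  [OURS · L1 W4.3] Replaces the role of NO printed item; NOT a statement of the manuscript under review
[claim: Hironaka2017, status: under-review].  AI work, weaker than expert review.

## References

* D. Abramovich, M. H. Quek, B. Schober, arXiv:2507.01232 (v3, 2026), Thm 1.3 (3), §5. [AbramovichQuekSchober2025]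
* J. Włodarczyk, *Functorial resolution by torus actions*, arXiv:2203.03090, §2.3.9, §3.3. [Wlodarczyk2022]
-/

noncomputable section

open IsLocalRing Literature.AlgebraicGeometry.Resolution

set_option linter.dupNamespace false -- mandated namespace of this single-conjunct summit

namespace Summit.ResolutionOfSingularities.ResolutionOfSingularities.Theorems

namespace LocalGameEFTCylinder

variable {S : Type} [CommRing S]

/-! ### Regular systems of parameters derived from `(y, x, z)` -/

/-- `(x, y, z)` spans what `(y, x, z)` spans. [folklore] -/
theorem span_range_swap (y x z : S) : Ideal.span (Set.range ![x, y, z]) = Ideal.span (Set.range ![y, x, z]) := by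
  rw [Matrix.range_cons, Matrix.range_cons_cons_empty, Matrix.range_cons, Matrix.range_cons_cons_empty,
    Set.singleton_union, Set.singleton_union, Set.insert_comm]

/-- `(x, y - λx^r, z)` spans what `(y, x, z)` spans (`r ≥ 1`). [folklore] -/
theorem span_range_steepen (y x z lam : S) {r : ℕ} (hr : 0 < r) :
    Ideal.span (Set.range ![x, y - lam * x ^ r, z]) = Ideal.span (Set.range ![y, x, z]) := by
  rw [Matrix.range_cons, Matrix.range_cons_cons_empty, Matrix.range_cons, Matrix.range_cons_cons_empty,
    Set.singleton_union, Set.singleton_union]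
  have hx1 : x ∈ Ideal.span ({x, y - lam * x ^ r, z} : Set S) := Ideal.subset_span (by simp)
  have hx2 : x ∈ Ideal.span ({y, x, z} : Set S) := Ideal.subset_span (by simp)
  have hxr : ∀ I : Ideal S, x ∈ I → lam * x ^ r ∈ I := fun I hx => by
    rw [← Nat.sub_add_cancel hr, pow_succ, ← mul_assoc]
    exact I.mul_mem_left _ hx
  apply le_antisymm
  · rw [Ideal.span_le]
    intro s hs
    simp only [Set.mem_insert_iff, Set.mem_singleton_iff] at hs
    rcases hs with hs | hs | hs
    · rw [hs]; exact hx2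
    · rw [hs]; exact Ideal.sub_mem _ (Ideal.subset_span (by simp)) (hxr _ hx2)
    · rw [hs]; exact Ideal.subset_span (by simp)
  · rw [Ideal.span_le]
    intro s hs
    simp only [Set.mem_insert_iff, Set.mem_singleton_iff] at hs
    rcases hs with hs | hs | hs
    · have h : s = (y - lam * x ^ r) + lam * x ^ r := by rw [hs]; ring
      rw [h]
      exact Ideal.add_mem _ (Ideal.subset_span (by simp)) (hxr _ hx1)
    · rw [hs]; exact hx1
    · rw [hs]; exact Ideal.subset_span (by simp)

/-! ### (L1) the coefficient of `y^ν` -/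

section Vertex

variable [IsLocalRing S] {y x z : S} {r q : ℕ}

/-- **(L1): the vertex coefficient is a unit.**  `q < r`, `f = Σ_{α ∈ supp l} l_α y^{α₀} x^{α₁}` with
`rα₀ + qα₁ ≥ rν` on the support and `f ∉ 𝔪^{ν+1}`: then the coefficient `l(ν, 0)` of `y^ν` is a unit (every other
monomial of the support has total degree `≥ ν + 1`). [cite: AbramovichQuekSchober2025, §5] -/
theorem residue_vertex_ne_zero (hyxz : Ideal.span (Set.range ![y, x, z]) = maximalIdeal S) (hlt : q < r)
    {κ : Type} [CommRing κ] {res : S →+* κ} (hres : ∀ a, res a = 0 → a ∈ maximalIdeal S) (l : (Fin 2 → ℕ) →₀ S)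
    {ν : ℕ} (hl : ∀ α ∈ l.support, r * ν ≤ ∑ i, ![r, q] i * α i) {f : S}
    (hf : f = ∑ α ∈ l.support, l α * ∏ i, ![y, x] i ^ α i) (hfν : f ∉ maximalIdeal S ^ (ν + 1)) :
    res (l ![ν, 0]) ≠ 0 := by
  intro h0
  have hmem : l ![ν, 0] ∈ maximalIdeal S := hres _ h0
  apply hfν
  rw [hf]
  refine Ideal.sum_mem _ fun α hα => ?_
  by_cases hαv : α = ![ν, 0]
  · subst hαv
    have hdeg : ν ≤ ∑ i, (![ν, 0] : Fin 2 → ℕ) i := by simp [Fin.sum_univ_two]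
    rw [pow_succ']
    exact Ideal.mul_mem_mul hmem (Ideal.pow_le_pow_right hdeg (prod_pow_mem_pow_pair hyxz _))
  · have hw := hl α hα
    rw [Fin.sum_univ_two] at hw
    simp only [Matrix.cons_val_zero, Matrix.cons_val_one] at hw
    have hdeg : ν + 1 ≤ ∑ i, α i := by
      rw [Fin.sum_univ_two]
      rcases Nat.eq_zero_or_pos (α 1) with h1 | h1
      · rw [h1, mul_zero, add_zero] at hw
        have hν : ν ≤ α 0 := Nat.le_of_mul_le_mul_left hw (by omega)
        have hne : α 0 ≠ ν := fun h => hαv (by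
          funext i; fin_cases i
          · exact h
          · exact h1)
        omega
      · have h2 : r * ν < r * (α 0 + α 1) := by nlinarith
        have := Nat.lt_of_mul_lt_mul_left h2
        omega
    exact Ideal.mul_mem_left _ _ (Ideal.pow_le_pow_right hdeg (prod_pow_mem_pow_pair hyxz α))

end Vertex

/-! ### The three degenerate positions -/

section Degenerate

variable [IsRegularLocalRing S] {y x z : S} {r q : ℕ}

omit [IsRegularLocalRing S] in
/-- The local equations of the cylinder move: `y = (t⁻¹)^r · Y`. [cite: Wlodarczyk2022, §2.3.9] -/
theorem algebraMap_y_eq : algebraMap S (extReesAlgebra (weightedMonomialIdeal ![y, x] ![r, q])) y =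
    extReesAlgebra.tInv (weightedMonomialIdeal ![y, x] ![r, q]) ^ r * LocalGameEFTPointMove.uT ![y, x] ![r, q] 0 := by
  have h := LocalGameEFTPointMove.algebraMap_u_eq ![y, x] ![r, q] 0
  simpa using h

omit [IsRegularLocalRing S] in
/-- The local equations of the cylinder move: `x = (t⁻¹)^q · X`. [cite: Wlodarczyk2022, §2.3.9] -/
theorem algebraMap_x_eq : algebraMap S (extReesAlgebra (weightedMonomialIdeal ![y, x] ![r, q])) x =
    extReesAlgebra.tInv (weightedMonomialIdeal ![y, x] ![r, q]) ^ q * LocalGameEFTPointMove.uT ![y, x] ![r, q] 1 := by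
  have h := LocalGameEFTPointMove.algebraMap_u_eq ![y, x] ![r, q] 1
  simpa using h

omit [IsRegularLocalRing S] in
/-- From `f/1 ∉ 𝔪^{(r+1)ν}` and `f = (t⁻¹)^{rν} G` to `G/1 ∉ 𝔪^ν`. [folklore] -/
theorem transform_notMem_pow_of_notMem (𝔫 : Ideal (extReesAlgebra (weightedMonomialIdeal ![y, x] ![r, q])))
    [𝔫.IsPrime] (hT : extReesAlgebra.tInv (weightedMonomialIdeal ![y, x] ![r, q]) ∈ 𝔫) {f : S} {ν : ℕ}
    {G : extReesAlgebra (weightedMonomialIdeal ![y, x] ![r, q])}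
    (hG : algebraMap S _ f = extReesAlgebra.tInv (weightedMonomialIdeal ![y, x] ![r, q]) ^ (r * ν) * G)
    (hf : algebraMap _ (Localization.AtPrime 𝔫)
      (algebraMap S (extReesAlgebra (weightedMonomialIdeal ![y, x] ![r, q])) f) ∉
      maximalIdeal (Localization.AtPrime 𝔫) ^ ((r + 1) * ν)) :
    algebraMap _ (Localization.AtPrime 𝔫) G ∉ maximalIdeal (Localization.AtPrime 𝔫) ^ ν := by
  rw [hG, map_mul, map_pow, add_mul, one_mul] at hf
  refine not_mem_pow_of_factor ?_ hf
  rw [← Localization.AtPrime.map_eq_maximalIdeal]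
  exact Ideal.mem_map_of_mem _ hT

/-- **Degenerate position `Y = 0`.**  If `Y ∈ 𝔫 ∌ X` and `f ∉ 𝒥_{(r+1)ν}((x, y, z); (q, r+1, 1))` (the tie ideal with
`λ̃ = 0`), then `G/1 ∉ 𝔪_𝔫^ν`. [cite: AbramovichQuekSchober2025, Thm 1.3 (3)] -/
theorem notMem_pow_of_Y_mem (hyxz : Ideal.span (Set.range ![y, x, z]) = maximalIdeal S)
    [hP : (Ideal.span (Set.range ![y, x])).IsPrime] (hzP : z ∉ Ideal.span (Set.range ![y, x]))
    {ρ : extReesAlgebra (weightedMonomialIdeal ![y, x] ![r, q]) →+*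
      MvPolynomial (Fin 2) (S ⧸ Ideal.span (Set.range ![y, x]))}
    (hρker : RingHom.ker ρ = Ideal.span {extReesAlgebra.tInv (weightedMonomialIdeal ![y, x] ![r, q])})
    (hρC : ∀ a : S, ρ (algebraMap S _ a) = MvPolynomial.C (Ideal.Quotient.mk _ a))
    {ρ₀ : extReesAlgebra (weightedMonomialIdeal ![y, x] ![r, q]) →+* MvPolynomial (Fin 2) (ResidueField S)}
    (hρ₀s : Function.Surjective ρ₀)
    (hρ₀ker : RingHom.ker ρ₀ = Ideal.span {extReesAlgebra.tInv (weightedMonomialIdeal ![y, x] ![r, q]),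
      algebraMap S _ z})
    (hX : ∀ i, ρ₀ (LocalGameEFTPointMove.uT ![y, x] ![r, q] i) = MvPolynomial.X i)
    (𝔫 : Ideal (extReesAlgebra (weightedMonomialIdeal ![y, x] ![r, q]))) [𝔫.IsPrime]
    (hT : extReesAlgebra.tInv (weightedMonomialIdeal ![y, x] ![r, q]) ∈ 𝔫) (hz : algebraMap S _ z ∈ 𝔫)
    {f : S} {ν : ℕ} {G : extReesAlgebra (weightedMonomialIdeal ![y, x] ![r, q])}
    (hG : algebraMap S _ f = extReesAlgebra.tInv (weightedMonomialIdeal ![y, x] ![r, q]) ^ (r * ν) * G)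
    (hq : 0 < q) (hY : LocalGameEFTPointMove.uT ![y, x] ![r, q] 0 ∈ 𝔫)
    (hXn : LocalGameEFTPointMove.uT ![y, x] ![r, q] 1 ∉ 𝔫)
    (hf : f ∉ weightedMonomialIdeal ![x, y, z] ![q, r + 1, 1] ((r + 1) * ν)) :
    algebraMap _ (Localization.AtPrime 𝔫) G ∉ maximalIdeal (Localization.AtPrime 𝔫) ^ ν := by
  refine transform_notMem_pow_of_notMem 𝔫 hT hG ?_
  have ha : Ideal.span (Set.range ![x, y, z]) = maximalIdeal S := by rw [span_range_swap, hyxz]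
  have hW : ρ₀ (LocalGameEFTPointMove.uT ![y, x] ![r, q] 0) =
      MvPolynomial.X 0 - MvPolynomial.C (0 : ResidueField S) * MvPolynomial.X 1 ^ r := by
    rw [hX, map_zero, zero_mul, sub_zero]
  exact not_mem_pow_of_notMem_steepened hzP hρker hρC hρ₀s hρ₀ker ha hq algebraMap_x_eq algebraMap_y_eq
    Fin.zero_ne_one hW 𝔫 hT hz hY hXn hf

/-- **Degenerate position `Y = λ̃X^r` (`q = 1`).**  If `W = Y - λ̃X^r ∈ 𝔫 ∌ X` and
`f ∉ 𝒥_{(r+1)ν}((x, y - λ̃x^r, z); (1, r+1, 1))`, then `G/1 ∉ 𝔪_𝔫^ν`. [cite: AbramovichQuekSchober2025, Thm 1.3 (3)] -/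
theorem notMem_pow_of_steep_mem (hyxz : Ideal.span (Set.range ![y, x, z]) = maximalIdeal S)
    [hP : (Ideal.span (Set.range ![y, x])).IsPrime] (hzP : z ∉ Ideal.span (Set.range ![y, x]))
    {ρ : extReesAlgebra (weightedMonomialIdeal ![y, x] ![r, q]) →+*
      MvPolynomial (Fin 2) (S ⧸ Ideal.span (Set.range ![y, x]))}
    (hρker : RingHom.ker ρ = Ideal.span {extReesAlgebra.tInv (weightedMonomialIdeal ![y, x] ![r, q])})
    (hρC : ∀ a : S, ρ (algebraMap S _ a) = MvPolynomial.C (Ideal.Quotient.mk _ a))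
    {ρ₀ : extReesAlgebra (weightedMonomialIdeal ![y, x] ![r, q]) →+* MvPolynomial (Fin 2) (ResidueField S)}
    (hρ₀s : Function.Surjective ρ₀)
    (hρ₀ker : RingHom.ker ρ₀ = Ideal.span {extReesAlgebra.tInv (weightedMonomialIdeal ![y, x] ![r, q]),
      algebraMap S _ z})
    (hX : ∀ i, ρ₀ (LocalGameEFTPointMove.uT ![y, x] ![r, q] i) = MvPolynomial.X i)
    (hC : ∀ a : S, ρ₀ (algebraMap S _ a) = MvPolynomial.C (residue S a))
    (𝔫 : Ideal (extReesAlgebra (weightedMonomialIdeal ![y, x] ![r, q]))) [𝔫.IsPrime]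
    (hT : extReesAlgebra.tInv (weightedMonomialIdeal ![y, x] ![r, q]) ∈ 𝔫) (hz : algebraMap S _ z ∈ 𝔫)
    {f : S} {ν : ℕ} {G : extReesAlgebra (weightedMonomialIdeal ![y, x] ![r, q])}
    (hG : algebraMap S _ f = extReesAlgebra.tInv (weightedMonomialIdeal ![y, x] ![r, q]) ^ (r * ν) * G)
    (hq1 : q = 1) (hr : 0 < r) (lam : S)
    (hWn : LocalGameEFTPointMove.uT ![y, x] ![r, q] 0 -
      algebraMap S _ lam * LocalGameEFTPointMove.uT ![y, x] ![r, q] 1 ^ r ∈ 𝔫)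
    (hXn : LocalGameEFTPointMove.uT ![y, x] ![r, q] 1 ∉ 𝔫)
    (hf : f ∉ weightedMonomialIdeal ![x, y - lam * x ^ r, z] ![q, r + 1, 1] ((r + 1) * ν)) :
    algebraMap _ (Localization.AtPrime 𝔫) G ∉ maximalIdeal (Localization.AtPrime 𝔫) ^ ν := by
  subst hq1
  refine transform_notMem_pow_of_notMem 𝔫 hT hG ?_
  have ha : Ideal.span (Set.range ![x, y - lam * x ^ r, z]) = maximalIdeal S := by
    rw [span_range_steepen _ _ _ _ hr, hyxz]
  have hW : ρ₀ (LocalGameEFTPointMove.uT ![y, x] ![r, 1] 0 -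
      algebraMap S _ lam * LocalGameEFTPointMove.uT ![y, x] ![r, 1] 1 ^ r) =
      MvPolynomial.X 0 - MvPolynomial.C (residue S lam) * MvPolynomial.X 1 ^ r := by
    rw [map_sub, map_mul, map_pow, hX, hX, hC]
  have hW₂ : algebraMap S (extReesAlgebra (weightedMonomialIdeal ![y, x] ![r, 1])) (y - lam * x ^ r) =
      extReesAlgebra.tInv (weightedMonomialIdeal ![y, x] ![r, 1]) ^ r *
        (LocalGameEFTPointMove.uT ![y, x] ![r, 1] 0 -
          algebraMap S _ lam * LocalGameEFTPointMove.uT ![y, x] ![r, 1] 1 ^ r) := by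
    rw [map_sub, map_mul, map_pow, algebraMap_y_eq, algebraMap_x_eq, pow_one]
    ring
  exact not_mem_pow_of_notMem_steepened hzP hρker hρC hρ₀s hρ₀ker ha one_pos algebraMap_x_eq hW₂
    Fin.zero_ne_one hW 𝔫 hT hz hWn hXn hf

/-- **Degenerate position `X = 0` (`q = r = 1`).**  If `X ∈ 𝔫 ∌ Y` and `f ∉ 𝒥_{2ν}((y, x, z); (1, 2, 1))`, then
`G/1 ∉ 𝔪_𝔫^ν`. [cite: AbramovichQuekSchober2025, Thm 1.3 (3)] -/
theorem notMem_pow_of_X_mem (hyxz : Ideal.span (Set.range ![y, x, z]) = maximalIdeal S)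
    [hP : (Ideal.span (Set.range ![y, x])).IsPrime] (hzP : z ∉ Ideal.span (Set.range ![y, x]))
    {ρ : extReesAlgebra (weightedMonomialIdeal ![y, x] ![r, q]) →+*
      MvPolynomial (Fin 2) (S ⧸ Ideal.span (Set.range ![y, x]))}
    (hρker : RingHom.ker ρ = Ideal.span {extReesAlgebra.tInv (weightedMonomialIdeal ![y, x] ![r, q])})
    (hρC : ∀ a : S, ρ (algebraMap S _ a) = MvPolynomial.C (Ideal.Quotient.mk _ a))
    {ρ₀ : extReesAlgebra (weightedMonomialIdeal ![y, x] ![r, q]) →+* MvPolynomial (Fin 2) (ResidueField S)}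
    (hρ₀s : Function.Surjective ρ₀)
    (hρ₀ker : RingHom.ker ρ₀ = Ideal.span {extReesAlgebra.tInv (weightedMonomialIdeal ![y, x] ![r, q]),
      algebraMap S _ z})
    (hX : ∀ i, ρ₀ (LocalGameEFTPointMove.uT ![y, x] ![r, q] i) = MvPolynomial.X i)
    (𝔫 : Ideal (extReesAlgebra (weightedMonomialIdeal ![y, x] ![r, q]))) [𝔫.IsPrime]
    (hT : extReesAlgebra.tInv (weightedMonomialIdeal ![y, x] ![r, q]) ∈ 𝔫) (hz : algebraMap S _ z ∈ 𝔫)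
    {f : S} {ν : ℕ} {G : extReesAlgebra (weightedMonomialIdeal ![y, x] ![r, q])}
    (hG : algebraMap S _ f = extReesAlgebra.tInv (weightedMonomialIdeal ![y, x] ![r, q]) ^ (r * ν) * G)
    (hq1 : q = 1) (hr1 : r = 1) (hXmem : LocalGameEFTPointMove.uT ![y, x] ![r, q] 1 ∈ 𝔫)
    (hYn : LocalGameEFTPointMove.uT ![y, x] ![r, q] 0 ∉ 𝔫)
    (hf : f ∉ weightedMonomialIdeal ![y, x, z] ![1, 2, 1] (2 * ν)) :
    algebraMap _ (Localization.AtPrime 𝔫) G ∉ maximalIdeal (Localization.AtPrime 𝔫) ^ ν := by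
  subst hq1 hr1
  refine transform_notMem_pow_of_notMem 𝔫 hT hG ?_
  have hW : ρ₀ (LocalGameEFTPointMove.uT ![y, x] ![1, 1] 1) =
      MvPolynomial.X 1 - MvPolynomial.C (0 : ResidueField S) * MvPolynomial.X 0 ^ 1 := by
    rw [hX, map_zero, zero_mul, sub_zero]
  have h01 : (1 : Fin 2) ≠ 0 := Fin.zero_ne_one.symm
  have h2 : (1 + 1) * ν = 2 * ν := by ring
  rw [h2]
  exact not_mem_pow_of_notMem_steepened hzP hρker hρC hρ₀s hρ₀ker hyxz one_pos algebraMap_y_eq algebraMap_x_eq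
    h01 hW 𝔫 hT hz hXmem hYn hf

end Degenerate

end LocalGameEFTCylinder

end Summit.ResolutionOfSingularities.ResolutionOfSingularities.Theorems

end
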